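import Summits.BirchSwinnertonDyer.BirchSwinnertonDyer.Theorems.ByReductionTypeAtTwoRankOneAtTwoBigImageOddLocalOneDoorKolyvaginExactBridgeSupply
import Summits.BirchSwinnertonDyer.BirchSwinnertonDyer.Theorems.ByReductionTypeAtTwoRankOneAtTwoBigImageOddLocalOneDoorSubsliceSplit
import Summits.BirchSwinnertonDyer.BirchSwinnertonDyer.Theorems.ByReductionTypeAtTwoRankOneAtTwoOneDoorLawFirstLayerDefs
import Summits.BirchSwinnertonDyer.BirchSwinnertonDyer.Theorems.GenusKolyvaginAtTwoCyclicTorsionOfNegDisc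
import Summits.BirchSwinnertonDyer.BirchSwinnertonDyer.Theorems.GenusKolyvaginAtTwoEquivariantChebotarevAtTwoR
import HarnessLib

/-!
# Route ByReductionTypeAtTwo, crux `RankOneAtTwoBigImageOddLocal` (stmt-BirchSwinnertonDyer-23715), LINE v8.17 `one_door_analytic`:
# THE W-BRIDGES — route GenusKolyvaginAtTwo's LIVE odd-Tamagawa exactness items BY NAME (Q4_T `KolyvaginExactAtTwoPosDiscT`, 23240, `Δ > 0`;
# Q3R_T `EquivariantKolyvaginExactAtTwoRT`, 23239, `Δ < 0`, fed by Q2 `KolyvaginRelationAtTwo` and the PROVED Q1 / Q5R) ⟹ the residues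
# R_N `DoorIndexLawFullCAtTwoSomeDoorResidueNonEgg`, R_S `DoorIndexLawFullCAtTwoSomeDoorResidueSha`, and the crux, on the slice

Width prover seat `bsd-line-fkl-p2` g14 (2026-08-29; pen ruling RC-359 (2), lead report G16 §4/§6), `--supports stmt-BirchSwinnertonDyer-23715` (helper).
THEOREMS ONLY; CONDITIONAL by design; BSD is not proved by any of this.  The sibling route's parent crux `KolyvaginExactAtTwo` (22137) is SPLIT; its live
odd-Tamagawa pieces are Q4_T (stmt-23240, `0 < Δ_W`) and Q3R_T (stmt-23239, `Δ_W < 0`; antecedents Q2 `KolyvaginRelationAtTwo` stmt-24880 OPEN, Q5R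
`EquivariantChebotarevAtTwoR` and Q1 `CyclicTorsionOfNegDisc` PROVED — `GenusExact.equivariantChebotarevAtTwoR_proof`, `GenusCyclicTorsion.cyclicTorsionOfNegDisc_proof`).
The fkl slice has odd Tamagawa product throughout, so R_N's habitat (`Δ_W > 0`, `Ш(W)[2] = 0`, non-egg) lies inside Q4_T's and R_S's (`Ш(W)[2] ≠ 0`) inside
Q4_T's ∪ Q3R_T's.  This is g7's bridge (`…OneDoorKolyvaginExactBridge.lean` / `…BridgeSupply.lean`, from the UNSPLIT parent) re-sourced from the T-pieces:
§1 per datum `bsdp_two_of_card_sha_baseChange_eq_two_pow_at` (the items' CONCLUSION `#Ш(E_K)[2^∞] = 2^{2M₀}` as hypothesis ⟹ `BSDp W 2`), instantiated from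
Q4_T / Q2 + Q3R_T BY NAME; §2 the Kolyvagin package of a slice curve (door by Hoffstein–Luo, odd-constant datum by `S_manin`, `d₁` by Darmon Thm. 3.6 PROVED,
`y_K` non-torsion by Gross–Zagier, `M₀` by finite generation); §3 `BSDp` on the slice and the crux BY NAME from {Q4_T, Q2, Q3R_T} + Kolyvagin's conjecture
at `2` on the slice's doors (`hKC`, derived-point form, g7's binder) + `S_manin` + PRINT + rank-`0` `BSD₂`; §4 THE W-BRIDGES `residueNonEgg_of_kolyvaginExactAtTwoPosDiscT`
(R_N ⟸ Q4_T + …; Q2/Q3R_T not needed) and `residueSha_of_genusItemsT` (R_S ⟸ Q4_T + Q2 + Q3R_T + …) through `hasLawfulDoorAtTwo_of_bsdp_two`.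
Net cone: {PRINT⁶, `S_manin`, Kolyvagin's conjecture at 2 (slice doors), 23240, 24880, 23239, rank-0 cruxes}.  Nothing is asserted.

References: [GrossLMS1991] §2 Conj. (2.2), §§3–4, §10; [McCallumLMS1991] §5; [Kolyvagin1990] Thm. A; [GrossZagier1986] Thm. I.6.3, V.§2; [Darmon2004] Thm. 3.6;
[HoffsteinLuo1997] Theorem (§1); [Milne1972ArithmeticAV] §1 Thm. 1; [Miller2011LMS] Def. 1.1.
-/

set_option autoImplicit false
-- the Theorems namespace of this sub repeats the summit name by design (D-0017 nested layout)
set_option linter.dupNamespace false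

noncomputable section

open scoped Classical

namespace Summit.BirchSwinnertonDyer.BirchSwinnertonDyer.Theorems.RankOneAtTwoOneDoor

open WeierstrassCurve NumberField Literature.NumberTheory.EllipticCurves Literature.NumberTheory.EllipticCurves.ModularForms
  Literature.NumberTheory.EllipticCurves.Rank1Residual
  Literature.NumberTheory.EllipticCurves.Rank1Residual.Typed
  Literature.NumberTheory.EllipticCurves.KrizLi2019
  Summit.BirchSwinnertonDyer.Rank1Residual
  Summit.BirchSwinnertonDyer.Rank1Residual.AdditivePotMult
  Summit.BirchSwinnertonDyer.Rank1Residual.F1Sign2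
  Summit.BirchSwinnertonDyer.Rank1Residual.F1Sign2.TranspositionDoor
  Summit.BirchSwinnertonDyer.BirchSwinnertonDyer.Theses.ByReductionTypeAtTwo
  Summit.BirchSwinnertonDyer.BirchSwinnertonDyer.Theses.GenusKolyvaginAtTwo
  Summit.BirchSwinnertonDyer.BirchSwinnertonDyer.Theorems.CMExactDescent

/-! ### §1 Per datum: `BSD(W, 2)` from `#Ш(E_K)[2^∞] = 2^{2M₀}` at an odd-constant Kolyvagin-admissible datum -/

/-- **`BSD(W, 2)` PER DATUM FROM THE EXACTNESS CONCLUSION.**  `W/ℚ` globally minimal, non-CM, `ρ̄_{W,2}` onto, odd Tamagawa product, analytic rank `1`; `K`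
imaginary quadratic with odd `d_K ≠ −3` and the Heegner hypothesis; `Dt` an ODD-constant datum, `β`, `ι`, `d₁` conductor-`1` with `y_K = P(1)` of infinite
order and `2^{M₀} ∥ P(1)` in `E(K[1])`; and `#Ш(E_K)[2^∞] = 2^{2M₀}` (`hsha`).  PRINT: `hGZ`, `hGZK`, `hmod`, `hMilneC`; rank-`0` `BSD₂` of non-CM curves `hZ`.
THEN `BSDp W 2`: the twin is non-CM of analytic rank `0` (`L(W^{(d_K)},1) ≠ 0` from `y_K` non-torsion by Gross–Zagier over `K`), `BSD₂` for a minimal model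
of it from `hZ`, and `CMExactDescent.bsdp_two_of_card_sha_baseChange_eq_of_facts_rankOne` concludes.  (g7's `bsdp_two_of_kolyvaginExactAtTwo_at`, the item's
conclusion in place of the item.) [cite: GrossZagier1986, V.§2] [cite: McCallumLMS1991, §5] [cite: Milne1972ArithmeticAV, §1 Thm. 1] [cite: Miller2011LMS, Def. 1.1] -/
theorem bsdp_two_of_card_sha_baseChange_eq_two_pow_at
    (hGZ : ∀ (N : ℕ) [NeZero N] (W : WeierstrassCurve ℚ) (K : Type) [Field K] [NumberField K], gross_zagier N W K)
    (hGZK : rank_eq_analyticRank_of_analyticRank_le_one) (hmod : hasEntireLFunction_rat)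
    (hMilneC : Milne1972.bsdQuotient_baseChange_quadratic_anyModel) (hZ : S_rankZeroTwin)
    (W : WeierstrassCurve ℚ) [W.IsElliptic] [W.IsGloballyMinimal] [NeZero (W.conductorNorm ℤ)]
    (hCM : ¬ W.HasCM) (hρ2 : W.HasSurjectiveModNGaloisRep 2) (hc : Odd W.tamagawaProduct) (hr : W.analyticRank = 1)
    (K : Type) [Field K] [NumberField K] (hK : IsImaginaryQuadratic K) (hodd : Odd (NumberField.discr K))
    (h3 : NumberField.discr K ≠ -3) (hH : SatisfiesHeegnerHypothesis (W.conductorNorm ℤ) K)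
    (Dt : ModularParametrizationData W (W.conductorNorm ℤ)) (hcM : Odd Dt.c) (β : ℤ) (ι : K →+* ℂ)
    (d₁ : KolyvaginHeegnerData Dt β ι 1) (hy : ¬ IsOfFinAddOrder d₁.derivedPoint) (M₀ : ℕ)
    (hdiv : ∃ Q : (W.baseChange (ringClassField K ι 1)).toAffine.Point, ((2 ^ M₀ : ℕ) : ℤ) • Q = d₁.derivedPoint)
    (hndiv : ¬ ∃ Q : (W.baseChange (ringClassField K ι 1)).toAffine.Point,
      ((2 ^ (M₀ + 1) : ℕ) : ℤ) • Q = d₁.derivedPoint)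
    (hsha : Nat.card (AddCommGroup.primaryComponent (W.baseChange K).sha 2) = 2 ^ (2 * M₀)) :
    BSDp W 2 := by
  -- the twin: a globally minimal model, non-CM, of analytic rank `0`; its `BSD₂` from the rank-`0` statement
  have hD0 : (NumberField.discr K : ℚ) ≠ 0 := by exact_mod_cast NumberField.discr_ne_zero K
  haveI hEt : (W.quadraticTwist (NumberField.discr K : ℚ)).IsElliptic := W.isElliptic_quadraticTwist hD0
  obtain ⟨Cd, hCd⟩ := hasGlobalMinimalModel_rat_holds (W.quadraticTwist (NumberField.discr K : ℚ))
  haveI : (Cd • W.quadraticTwist (NumberField.discr K : ℚ)).IsGloballyMinimal := hCd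
  have hCMd : ¬ (Cd • W.quadraticTwist (NumberField.discr K : ℚ)).HasCM :=
    RamifiedPairUpperBound.not_hasCM_of_smul_quadraticTwist_eq hD0 rfl hCM
  -- `L(E^{(d_K)}, 1) ≠ 0` from the non-torsion of `y_K` (Gross–Zagier over `K`)
  obtain ⟨P₀, Hd, hP₀, hP₀K⟩ := exists_heegnerPoint_map_eq_derivedPoint_one hK hH d₁
  have hPinf : ¬ IsOfFinAddOrder P₀ := by
    intro hfin
    apply hy
    rw [← hP₀K]
    exact (WeierstrassCurve.Affine.Point.map (W' := W)
      (algebraMap K (ringClassField K ι 1)).toRatAlgHom).isOfFinAddOrder hfin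
  have hLK : LDerivEK W K ≠ 0 :=
    (lDerivEK_ne_zero_iff_not_isOfFinAddOrder W (W.conductorNorm ℤ) K (hGZ _ W K) hK hH
      ⟨Dt, Hd, ι, hP₀⟩).mpr hPinf
  have hL0 : W.entireLFunction 1 = 0 := entireLFunction_one_eq_zero_of_analyticRank_eq_one hr
  have hLt : (W.quadraticTwist (NumberField.discr K : ℚ)).entireLFunction 1 ≠ 0 := by
    intro h0
    apply hLK
    rw [lDerivEK_eq_deriv_mul W K hmod hL0, h0, mul_zero]
  have hrt : (W.quadraticTwist (NumberField.discr K : ℚ)).analyticRank = 0 :=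
    ((W.quadraticTwist _).analyticRank_eq_zero_iff_holds (hmod _)).mpr hLt
  have hrd : (Cd • W.quadraticTwist (NumberField.discr K : ℚ)).analyticRank = 0 := by
    rw [analyticRank_smul, hrt]
  have hBd : BSDp (Cd • W.quadraticTwist (NumberField.discr K : ℚ)) 2 := hZ _ hCMd hrd
  exact bsdp_two_of_card_sha_baseChange_eq_of_facts_rankOne W K Dt β ι d₁
    (Cd • W.quadraticTwist (NumberField.discr K : ℚ)) (hGZ _ W K) hGZK hmod hMilneC hρ2 hc hr hK hodd h3 hH hcM hy hdiv
    hndiv hsha ⟨Cd, rfl⟩ hBd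

/-- `ρ_{W,2^n}` onto for all `n` in the items' spelling `(2 : ℤ) ^ n`, and `ρ̄_{W,2}` onto. -/
theorem hasSurjectiveModNGaloisRep_pow_of_tower (W : WeierstrassCurve ℚ)
    (hsurj : ∀ n : ℕ, W.HasSurjectiveModNGaloisRep ((2 ^ n : ℕ) : ℤ)) :
    (∀ m : ℕ, 0 < m → W.HasSurjectiveModNGaloisRep ((2 : ℤ) ^ m)) ∧ W.HasSurjectiveModNGaloisRep 2 := by
  have hρ : ∀ m : ℕ, 0 < m → W.HasSurjectiveModNGaloisRep ((2 : ℤ) ^ m) := fun m _ => by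
    have h := hsurj m
    push_cast at h
    exact h
  refine ⟨hρ, ?_⟩
  have h := hρ 1 one_pos
  rwa [pow_one] at h

/-- **`BSD(W, 2)` PER DATUM FROM Q4_T `KolyvaginExactAtTwoPosDiscT` (stmt-23240) BY NAME** on the `Δ_W > 0` part of the slice: the item, applied at the datum
and at a `2`-indivisible derived point `P(n)` (`n` square-free product of Kolyvagin primes at `2`), gives `#Ш(E_K)[2^∞] = 2^{2M₀}`, and
`bsdp_two_of_card_sha_baseChange_eq_two_pow_at` concludes.  CONDITIONAL by design. [cite: GrossLMS1991, §§3–4 and §10] [cite: McCallumLMS1991, §5] -/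
theorem bsdp_two_of_kolyvaginExactAtTwoPosDiscT_at
    (hGZ : ∀ (N : ℕ) [NeZero N] (W : WeierstrassCurve ℚ) (K : Type) [Field K] [NumberField K], gross_zagier N W K)
    (hGZK : rank_eq_analyticRank_of_analyticRank_le_one) (hmod : hasEntireLFunction_rat)
    (hMilneC : Milne1972.bsdQuotient_baseChange_quadratic_anyModel) (hX4 : KolyvaginExactAtTwoPosDiscT) (hZ : S_rankZeroTwin)
    (W : WeierstrassCurve ℚ) [W.IsElliptic] [W.IsGloballyMinimal] [NeZero (W.conductorNorm ℤ)]
    (hCM : ¬ W.HasCM) (hsurj : ∀ n : ℕ, W.HasSurjectiveModNGaloisRep ((2 ^ n : ℕ) : ℤ)) (hc : Odd W.tamagawaProduct)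
    (hΔ : 0 < W.Δ) (hr : W.analyticRank = 1)
    (K : Type) [Field K] [NumberField K] (hK : IsImaginaryQuadratic K) (hodd : Odd (NumberField.discr K))
    (h3 : NumberField.discr K ≠ -3) (hH : SatisfiesHeegnerHypothesis (W.conductorNorm ℤ) K)
    (hsq1 : ¬ IsSquare ((NumberField.discr K : ℚ) * -|W.Δ|))
    (hsq2 : ¬ IsSquare ((NumberField.discr K : ℚ) * (-(2 * |W.Δ|))))
    (Dt : ModularParametrizationData W (W.conductorNorm ℤ)) (hcM : Odd Dt.c) (β : ℤ) (ι : K →+* ℂ)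
    (d₁ : KolyvaginHeegnerData Dt β ι 1) (hy : ¬ IsOfFinAddOrder d₁.derivedPoint) (M₀ : ℕ)
    (hdiv : ∃ Q : (W.baseChange (ringClassField K ι 1)).toAffine.Point, ((2 ^ M₀ : ℕ) : ℤ) • Q = d₁.derivedPoint)
    (hndiv : ¬ ∃ Q : (W.baseChange (ringClassField K ι 1)).toAffine.Point,
      ((2 ^ (M₀ + 1) : ℕ) : ℤ) • Q = d₁.derivedPoint)
    (n : ℕ) (d : KolyvaginHeegnerData Dt β ι n) (hn : Squarefree n)
    (hKoly : ∀ ℓ ∈ n.primeFactors, Zhang2014.IsKolyvaginPrime (W.conductorNorm ℤ) W K 2 ℓ)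
    (hPn : ¬ ∃ Q : (W.baseChange (ringClassField K ι n)).toAffine.Point, (2 : ℤ) • Q = d.derivedPoint) :
    BSDp W 2 := by
  obtain ⟨hρ, hρ2⟩ := hasSurjectiveModNGaloisRep_pow_of_tower W hsurj
  have hsha : Nat.card (AddCommGroup.primaryComponent (W.baseChange K).sha 2) = 2 ^ (2 * M₀) :=
    hX4 W hCM hc hΔ K hK hodd h3 hH hsq1 hsq2 hρ Dt β ι d₁ hy M₀ hdiv hndiv n d hn hKoly hPn
  exact bsdp_two_of_card_sha_baseChange_eq_two_pow_at hGZ hGZK hmod hMilneC hZ W hCM hρ2 hc hr K hK hodd h3 hH Dt hcM β ι d₁ hy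
    M₀ hdiv hndiv hsha

/-- **`BSD(W, 2)` PER DATUM FROM Q3R_T `EquivariantKolyvaginExactAtTwoRT` (stmt-23239) BY NAME** on the `Δ_W < 0` part of the slice, with its antecedents:
Q2 `KolyvaginRelationAtTwo` (stmt-24880, OPEN — a hypothesis), Q5R `EquivariantChebotarevAtTwoR` and Q1 `CyclicTorsionOfNegDisc` (both PROVED in the tree
and fed BY NAME).  CONDITIONAL by design. [cite: GrossLMS1991, §§3–4 and §10] [cite: McCallumLMS1991, §5] -/
theorem bsdp_two_of_equivariantKolyvaginExactAtTwoRT_at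
    (hGZ : ∀ (N : ℕ) [NeZero N] (W : WeierstrassCurve ℚ) (K : Type) [Field K] [NumberField K], gross_zagier N W K)
    (hGZK : rank_eq_analyticRank_of_analyticRank_le_one) (hmod : hasEntireLFunction_rat)
    (hMilneC : Milne1972.bsdQuotient_baseChange_quadratic_anyModel) (hQ2 : KolyvaginRelationAtTwo)
    (hRT : EquivariantKolyvaginExactAtTwoRT) (hZ : S_rankZeroTwin)
    (W : WeierstrassCurve ℚ) [W.IsElliptic] [W.IsGloballyMinimal] [NeZero (W.conductorNorm ℤ)]
    (hCM : ¬ W.HasCM) (hsurj : ∀ n : ℕ, W.HasSurjectiveModNGaloisRep ((2 ^ n : ℕ) : ℤ)) (hc : Odd W.tamagawaProduct)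
    (hΔ : W.Δ < 0) (hr : W.analyticRank = 1)
    (K : Type) [Field K] [NumberField K] (hK : IsImaginaryQuadratic K) (hodd : Odd (NumberField.discr K))
    (h3 : NumberField.discr K ≠ -3) (hH : SatisfiesHeegnerHypothesis (W.conductorNorm ℤ) K)
    (hsq1 : ¬ IsSquare ((NumberField.discr K : ℚ) * -|W.Δ|))
    (hsq2 : ¬ IsSquare ((NumberField.discr K : ℚ) * (-(2 * |W.Δ|))))
    (Dt : ModularParametrizationData W (W.conductorNorm ℤ)) (hcM : Odd Dt.c) (β : ℤ) (ι : K →+* ℂ)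
    (d₁ : KolyvaginHeegnerData Dt β ι 1) (hy : ¬ IsOfFinAddOrder d₁.derivedPoint) (M₀ : ℕ)
    (hdiv : ∃ Q : (W.baseChange (ringClassField K ι 1)).toAffine.Point, ((2 ^ M₀ : ℕ) : ℤ) • Q = d₁.derivedPoint)
    (hndiv : ¬ ∃ Q : (W.baseChange (ringClassField K ι 1)).toAffine.Point,
      ((2 ^ (M₀ + 1) : ℕ) : ℤ) • Q = d₁.derivedPoint)
    (n : ℕ) (d : KolyvaginHeegnerData Dt β ι n) (hn : Squarefree n)
    (hKoly : ∀ ℓ ∈ n.primeFactors, Zhang2014.IsKolyvaginPrime (W.conductorNorm ℤ) W K 2 ℓ)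
    (hPn : ¬ ∃ Q : (W.baseChange (ringClassField K ι n)).toAffine.Point, (2 : ℤ) • Q = d.derivedPoint) :
    BSDp W 2 := by
  obtain ⟨hρ, hρ2⟩ := hasSurjectiveModNGaloisRep_pow_of_tower W hsurj
  have hsha : Nat.card (AddCommGroup.primaryComponent (W.baseChange K).sha 2) = 2 ^ (2 * M₀) :=
    hRT hQ2 GenusExact.equivariantChebotarevAtTwoR_proof GenusCyclicTorsion.cyclicTorsionOfNegDisc_proof W hCM hc hΔ K hK hodd h3 hH
      hsq1 hsq2 hρ Dt β ι d₁ hy M₀ hdiv hndiv n d hn hKoly hPn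
  exact bsdp_two_of_card_sha_baseChange_eq_two_pow_at hGZ hGZK hmod hMilneC hZ W hCM hρ2 hc hr K hK hodd h3 hH Dt hcM β ι d₁ hy
    M₀ hdiv hndiv hsha

/-! ### §2 The Kolyvagin package of a slice curve (theorem-grade modulo PRINT + `S_manin`) -/

/-- **THE KOLYVAGIN PACKAGE.**  For `W/ℚ` globally minimal with `E(ℚ)[2] = 0` (odd torsion order) and analytic rank `1`, modulo modularity (`hnf`), Hoffstein–Luo
(`hHL`), Gross–Zagier (`hGZ`) and the odd-constant parametrisation `S_manin` (`hMan`): a Kolyvagin-admissible door `K` (odd `d_K ≠ −3`, Heegner hypothesis,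
`d_K·(−|Δ|)`, `d_K·(−2|Δ|)` non-squares), an odd-constant datum `Dt`, `β`, `ι`, a conductor-`1` Kolyvagin–Heegner datum `d₁` (Darmon Thm. 3.6, PROVED) with
`y_K = P(1)` of infinite order (Gross–Zagier over `K`: `L'(W/K,1) = L'(W,1)·L(W^{(d_K)},1) ≠ 0`) and its exact `2`-divisibility exponent `M₀` in `E(K[1])`
(finite generation).  Extracted from g7's `rankOneAtTwoBigImageOddLocal_of_kolyvaginExactAtTwo_of_kolyvaginConjecture`.
[cite: HoffsteinLuo1997, Theorem (§1)] [cite: Darmon2004, Thm. 3.6] [cite: GrossZagier1986, Thm. I.6.3 and V.§2] -/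
theorem exists_kolyvaginPackage_of_manin
    (hGZ : ∀ (N : ℕ) [NeZero N] (W : WeierstrassCurve ℚ) (K : Type) [Field K] [NumberField K], gross_zagier N W K)
    (hnf : exists_isNewformOf) (hHL : HoffsteinLuo1997_exists_twist_L_one_ne_zero) (hMan : S_manin)
    (W : WeierstrassCurve ℚ) [W.IsElliptic] [W.IsGloballyMinimal] [NeZero (W.conductorNorm ℤ)]
    (hT : Odd W.torsionOrder) (hr : W.analyticRank = 1) :
    ∃ (K : Type) (_ : Field K) (_ : NumberField K), IsImaginaryQuadratic K ∧ Odd (NumberField.discr K) ∧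
      NumberField.discr K ≠ -3 ∧ SatisfiesHeegnerHypothesis (W.conductorNorm ℤ) K ∧
      ¬ IsSquare ((NumberField.discr K : ℚ) * -|W.Δ|) ∧ ¬ IsSquare ((NumberField.discr K : ℚ) * (-(2 * |W.Δ|))) ∧
      ∃ (Dt : ModularParametrizationData W (W.conductorNorm ℤ)) (β : ℤ) (ι : K →+* ℂ) (d₁ : KolyvaginHeegnerData Dt β ι 1),
        Odd Dt.c ∧ ¬ IsOfFinAddOrder d₁.derivedPoint ∧
        ∃ M₀ : ℕ, (∃ Q : (W.baseChange (ringClassField K ι 1)).toAffine.Point, ((2 ^ M₀ : ℕ) : ℤ) • Q = d₁.derivedPoint) ∧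
          (¬ ∃ Q : (W.baseChange (ringClassField K ι 1)).toAffine.Point, ((2 ^ (M₀ + 1) : ℕ) : ℤ) • Q = d₁.derivedPoint) := by
  have hmod : hasEntireLFunction_rat := hasEntireLFunction_rat_of_exists_isNewformOf hnf
  -- the Kolyvagin-admissible door
  obtain ⟨K, _iF, _iN, hK, hodd, h3, hH, hsq1, hsq2, -, hLt, -⟩ :=
    exists_kolyvaginDoorField_of_analyticRank_eq_one hnf hHL W hr
  -- the odd-constant datum, the orientation, the embedding, the conductor-`1` datum
  have hT2 : NoRationalTwoTorsion W := noRationalTwoTorsion_of_odd_torsionOrder W hT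
  obtain ⟨Dt, hc2⟩ := hMan W hT2
  have hcM : Odd Dt.c := Int.not_even_iff_odd.mp fun h => hc2 (even_iff_two_dvd.mp h)
  obtain ⟨β, hβ⟩ : ∃ β : ℤ, (4 * (W.conductorNorm ℤ : ℕ) : ℤ) ∣ β ^ 2 - NumberField.discr K :=
    Literature.NumberTheory.QuadraticFields.Quadratic.exists_dvd_sq_sub_discr_of_ncard_primesOver hK.1 (NeZero.ne _) hH
  obtain ⟨ι⟩ : Nonempty (K →+* ℂ) := inferInstance
  obtain ⟨d₁⟩ := exists_kolyvaginHeegnerData_one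
    (phi_heegnerTau_mem_singularModuliField_holds (W.conductorNorm ℤ) W K) hK Dt β ι hβ
  -- `y_K` has infinite order: `L'(W/K, 1) = L'(W, 1) · L(W^{(d_K)}, 1) ≠ 0` and Gross–Zagier
  haveI hEK : (W.baseChange K).IsElliptic := isElliptic_baseChange' W K
  have hL0 : W.entireLFunction 1 = 0 := entireLFunction_one_eq_zero_of_analyticRank_eq_one hr
  obtain ⟨-, hderiv⟩ := leadingLCoeff_eq_deriv_of_analyticRank_eq_one hr
  have hLK : LDerivEK W K ≠ 0 := by
    rw [lDerivEK_eq_deriv_mul W K hmod hL0]; exact mul_ne_zero hderiv hLt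
  obtain ⟨P₀, Hd, hP₀, hP₀K⟩ := exists_heegnerPoint_map_eq_derivedPoint_one hK hH d₁
  have hP₀inf : ¬ IsOfFinAddOrder P₀ :=
    (lDerivEK_ne_zero_iff_not_isOfFinAddOrder W (W.conductorNorm ℤ) K (hGZ _ W K) hK hH ⟨Dt, Hd, ι, hP₀⟩).mp hLK
  have hy : ¬ IsOfFinAddOrder d₁.derivedPoint := by
    intro hfin
    apply hP₀inf
    rw [← hP₀K] at hfin
    exact (WeierstrassCurve.Affine.Point.map_injective (W' := W) _).isOfFinAddOrder_iff.mp hfin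
  -- `M₀ = ord₂(y_K)` in `E(K[1])` (a number field: finite generation)
  obtain ⟨M₀, hdiv, hndiv⟩ : ∃ M₀ : ℕ,
      (∃ Q : (W.baseChange (ringClassField K ι 1)).toAffine.Point, ((2 ^ M₀ : ℕ) : ℤ) • Q = d₁.derivedPoint) ∧
      ¬ ∃ Q : (W.baseChange (ringClassField K ι 1)).toAffine.Point, ((2 ^ (M₀ + 1) : ℕ) : ℤ) • Q = d₁.derivedPoint := by
    haveI : NumberField (ringClassField K ι 1) := numberField_ringClassField hK ι one_ne_zero
    haveI : (W.baseChange (ringClassField K ι 1)).IsElliptic := by rw [baseChange]; infer_instance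
    haveI : Module.Finite ℤ (W.baseChange (ringClassField K ι 1)).toAffine.Point := by
      convert (W.baseChange (ringClassField K ι 1)).module_finite_point_holds
    exact exists_pow_smul_eq_and_not_of_not_isOfFinAddOrder Nat.prime_two hy
  exact ⟨K, _iF, _iN, hK, hodd, h3, hH, hsq1, hsq2, Dt, β, ι, d₁, hcM, hy, M₀, hdiv, hndiv⟩

/-! ### §3 The slice from the T-items + Kolyvagin's conjecture at `2` -/

/-- **`BSD(W, 2)` ON THE `Δ_W > 0` PART OF THE SLICE FROM Q4_T** + Kolyvagin's conjecture at `2` on the slice's doors with `Δ_W > 0` (`hKC`, derived-point form: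
some square-free product `n` of Kolyvagin primes has `P(n) ∉ 2E(K[n])`) + `S_manin` + PRINT + rank-`0` `BSD₂`.  CONDITIONAL. [cite: GrossLMS1991, §2 Conj. (2.2) and §§3–4] -/
theorem bsdp_two_of_kolyvaginExactAtTwoPosDiscT
    (hGZ : ∀ (N : ℕ) [NeZero N] (W : WeierstrassCurve ℚ) (K : Type) [Field K] [NumberField K], gross_zagier N W K)
    (hGZK : rank_eq_analyticRank_of_analyticRank_le_one) (hnf : exists_isNewformOf)
    (hHL : HoffsteinLuo1997_exists_twist_L_one_ne_zero) (hMilneC : Milne1972.bsdQuotient_baseChange_quadratic_anyModel)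
    (hX4 : KolyvaginExactAtTwoPosDiscT) (hMan : S_manin)
    (hKC : ∀ (W : WeierstrassCurve ℚ) [W.IsElliptic] [W.IsGloballyMinimal] [NeZero (W.conductorNorm ℤ)],
      ¬ W.HasCM → (∀ n : ℕ, W.HasSurjectiveModNGaloisRep ((2 ^ n : ℕ) : ℤ)) → Odd W.tamagawaProduct → W.analyticRank = 1 → 0 < W.Δ →
      ∀ (K : Type) [Field K] [NumberField K], IsImaginaryQuadratic K → Odd (NumberField.discr K) →
        NumberField.discr K ≠ -3 → SatisfiesHeegnerHypothesis (W.conductorNorm ℤ) K →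
        ¬ IsSquare ((NumberField.discr K : ℚ) * -|W.Δ|) → ¬ IsSquare ((NumberField.discr K : ℚ) * (-(2 * |W.Δ|))) →
        ∀ (Dt : ModularParametrizationData W (W.conductorNorm ℤ)) (β : ℤ) (ι : K →+* ℂ) (d₁ : KolyvaginHeegnerData Dt β ι 1),
          Odd Dt.c → ¬ IsOfFinAddOrder d₁.derivedPoint →
          ∃ (n : ℕ) (d : KolyvaginHeegnerData Dt β ι n), Squarefree n ∧
            (∀ ℓ ∈ n.primeFactors, Zhang2014.IsKolyvaginPrime (W.conductorNorm ℤ) W K 2 ℓ) ∧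
            ¬ ∃ Q : (W.baseChange (ringClassField K ι n)).toAffine.Point, (2 : ℤ) • Q = d.derivedPoint)
    (hZ : S_rankZeroTwin)
    (W : WeierstrassCurve ℚ) [W.IsElliptic] [W.IsGloballyMinimal] [NeZero (W.conductorNorm ℤ)]
    (hCM : ¬ W.HasCM) (hsurj : ∀ n : ℕ, W.HasSurjectiveModNGaloisRep ((2 ^ n : ℕ) : ℤ)) (hT : Odd W.torsionOrder)
    (hc : Odd W.tamagawaProduct) (hr : W.analyticRank = 1) (hΔ : 0 < W.Δ) : BSDp W 2 := by
  have hmod : hasEntireLFunction_rat := hasEntireLFunction_rat_of_exists_isNewformOf hnf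
  obtain ⟨K, _iF, _iN, hK, hodd, h3, hH, hsq1, hsq2, Dt, β, ι, d₁, hcM, hy, M₀, hdiv, hndiv⟩ :=
    exists_kolyvaginPackage_of_manin hGZ hnf hHL hMan W hT hr
  obtain ⟨n, d, hn, hKoly, hPn⟩ := hKC W hCM hsurj hc hr hΔ K hK hodd h3 hH hsq1 hsq2 Dt β ι d₁ hcM hy
  exact bsdp_two_of_kolyvaginExactAtTwoPosDiscT_at hGZ hGZK hmod hMilneC hX4 hZ W hCM hsurj hc hΔ hr K hK hodd h3 hH hsq1 hsq2 Dt hcM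
    β ι d₁ hy M₀ hdiv hndiv n d hn hKoly hPn

/-- **`BSD(W, 2)` ON THE WHOLE SLICE FROM THE T-ITEMS {Q4_T, Q2 + Q3R_T}** (by the sign of `Δ_W ≠ 0`) + Kolyvagin's conjecture at `2` on the slice's doors (`hKC`, g7's
binder VERBATIM) + `S_manin` + PRINT + rank-`0` `BSD₂`.  CONDITIONAL by design. [cite: GrossLMS1991, §2 Conj. (2.2) and §§3–4] -/
theorem bsdp_two_of_genusItemsT
    (hGZ : ∀ (N : ℕ) [NeZero N] (W : WeierstrassCurve ℚ) (K : Type) [Field K] [NumberField K], gross_zagier N W K)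
    (hGZK : rank_eq_analyticRank_of_analyticRank_le_one) (hnf : exists_isNewformOf)
    (hHL : HoffsteinLuo1997_exists_twist_L_one_ne_zero) (hMilneC : Milne1972.bsdQuotient_baseChange_quadratic_anyModel)
    (hX4 : KolyvaginExactAtTwoPosDiscT) (hQ2 : KolyvaginRelationAtTwo) (hRT : EquivariantKolyvaginExactAtTwoRT) (hMan : S_manin)
    (hKC : ∀ (W : WeierstrassCurve ℚ) [W.IsElliptic] [W.IsGloballyMinimal] [NeZero (W.conductorNorm ℤ)],
      ¬ W.HasCM → (∀ n : ℕ, W.HasSurjectiveModNGaloisRep ((2 ^ n : ℕ) : ℤ)) → Odd W.tamagawaProduct → W.analyticRank = 1 →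
      ∀ (K : Type) [Field K] [NumberField K], IsImaginaryQuadratic K → Odd (NumberField.discr K) →
        NumberField.discr K ≠ -3 → SatisfiesHeegnerHypothesis (W.conductorNorm ℤ) K →
        ¬ IsSquare ((NumberField.discr K : ℚ) * -|W.Δ|) → ¬ IsSquare ((NumberField.discr K : ℚ) * (-(2 * |W.Δ|))) →
        ∀ (Dt : ModularParametrizationData W (W.conductorNorm ℤ)) (β : ℤ) (ι : K →+* ℂ) (d₁ : KolyvaginHeegnerData Dt β ι 1),
          Odd Dt.c → ¬ IsOfFinAddOrder d₁.derivedPoint →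
          ∃ (n : ℕ) (d : KolyvaginHeegnerData Dt β ι n), Squarefree n ∧
            (∀ ℓ ∈ n.primeFactors, Zhang2014.IsKolyvaginPrime (W.conductorNorm ℤ) W K 2 ℓ) ∧
            ¬ ∃ Q : (W.baseChange (ringClassField K ι n)).toAffine.Point, (2 : ℤ) • Q = d.derivedPoint)
    (hZ : S_rankZeroTwin)
    (W : WeierstrassCurve ℚ) [W.IsElliptic] [W.IsGloballyMinimal] [NeZero (W.conductorNorm ℤ)]
    (hCM : ¬ W.HasCM) (hsurj : ∀ n : ℕ, W.HasSurjectiveModNGaloisRep ((2 ^ n : ℕ) : ℤ)) (hT : Odd W.torsionOrder)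
    (hc : Odd W.tamagawaProduct) (hr : W.analyticRank = 1) : BSDp W 2 := by
  have hmod : hasEntireLFunction_rat := hasEntireLFunction_rat_of_exists_isNewformOf hnf
  obtain ⟨K, _iF, _iN, hK, hodd, h3, hH, hsq1, hsq2, Dt, β, ι, d₁, hcM, hy, M₀, hdiv, hndiv⟩ :=
    exists_kolyvaginPackage_of_manin hGZ hnf hHL hMan W hT hr
  obtain ⟨n, d, hn, hKoly, hPn⟩ := hKC W hCM hsurj hc hr K hK hodd h3 hH hsq1 hsq2 Dt β ι d₁ hcM hy
  rcases lt_or_gt_of_ne W.isUnit_Δ.ne_zero with hΔ | hΔ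
  · exact bsdp_two_of_equivariantKolyvaginExactAtTwoRT_at hGZ hGZK hmod hMilneC hQ2 hRT hZ W hCM hsurj hc hΔ hr K hK hodd h3 hH hsq1
      hsq2 Dt hcM β ι d₁ hy M₀ hdiv hndiv n d hn hKoly hPn
  · exact bsdp_two_of_kolyvaginExactAtTwoPosDiscT_at hGZ hGZK hmod hMilneC hX4 hZ W hCM hsurj hc hΔ hr K hK hodd h3 hH hsq1 hsq2 Dt hcM
      β ι d₁ hy M₀ hdiv hndiv n d hn hKoly hPn

/-- **THE CRUX `RankOneAtTwoBigImageOddLocal` BY NAME FROM ROUTE GenusKolyvaginAtTwo's LIVE T-ITEMS** Q4_T (stmt-23240), Q2 (stmt-24880), Q3R_T (stmt-23239) + Kolyvagin's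
conjecture at `2` on the slice's doors + `S_manin` + PRINT⁵ + rank-`0` `BSD₂` of non-CM curves (= this route's four rank-`0` cruxes).  Supersedes g7's
`rankOneAtTwoBigImageOddLocal_of_kolyvaginExactAtTwo_of_kolyvaginConjecture` (which consumed the UNSPLIT parent 22137): the odd-Tamagawa pieces suffice.
CONDITIONAL by design: BSD is not proved by this. [cite: GrossLMS1991, §2 Conj. (2.2), §§3–4 and §10] [cite: McCallumLMS1991, §5] [cite: Kolyvagin1990, Thm. A] -/
theorem rankOneAtTwoBigImageOddLocal_of_genusItemsT
    (hGZ : ∀ (N : ℕ) [NeZero N] (W : WeierstrassCurve ℚ) (K : Type) [Field K] [NumberField K], gross_zagier N W K)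
    (hGZK : rank_eq_analyticRank_of_analyticRank_le_one) (hnf : exists_isNewformOf)
    (hHL : HoffsteinLuo1997_exists_twist_L_one_ne_zero) (hMilneC : Milne1972.bsdQuotient_baseChange_quadratic_anyModel)
    (hX4 : KolyvaginExactAtTwoPosDiscT) (hQ2 : KolyvaginRelationAtTwo) (hRT : EquivariantKolyvaginExactAtTwoRT) (hMan : S_manin)
    (hKC : ∀ (W : WeierstrassCurve ℚ) [W.IsElliptic] [W.IsGloballyMinimal] [NeZero (W.conductorNorm ℤ)],
      ¬ W.HasCM → (∀ n : ℕ, W.HasSurjectiveModNGaloisRep ((2 ^ n : ℕ) : ℤ)) → Odd W.tamagawaProduct → W.analyticRank = 1 →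
      ∀ (K : Type) [Field K] [NumberField K], IsImaginaryQuadratic K → Odd (NumberField.discr K) →
        NumberField.discr K ≠ -3 → SatisfiesHeegnerHypothesis (W.conductorNorm ℤ) K →
        ¬ IsSquare ((NumberField.discr K : ℚ) * -|W.Δ|) → ¬ IsSquare ((NumberField.discr K : ℚ) * (-(2 * |W.Δ|))) →
        ∀ (Dt : ModularParametrizationData W (W.conductorNorm ℤ)) (β : ℤ) (ι : K →+* ℂ) (d₁ : KolyvaginHeegnerData Dt β ι 1),
          Odd Dt.c → ¬ IsOfFinAddOrder d₁.derivedPoint →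
          ∃ (n : ℕ) (d : KolyvaginHeegnerData Dt β ι n), Squarefree n ∧
            (∀ ℓ ∈ n.primeFactors, Zhang2014.IsKolyvaginPrime (W.conductorNorm ℤ) W K 2 ℓ) ∧
            ¬ ∃ Q : (W.baseChange (ringClassField K ι n)).toAffine.Point, (2 : ℤ) • Q = d.derivedPoint)
    (hZ : S_rankZeroTwin) : RankOneAtTwoBigImageOddLocal := by
  intro W _ _ hCM hsurj hT hc hr
  haveI hN : NeZero (W.conductorNorm ℤ) := ⟨(W.conductorNorm_pos_holds).ne'⟩
  exact bsdp_two_of_genusItemsT hGZ hGZK hnf hHL hMilneC hX4 hQ2 hRT hMan hKC hZ W hCM hsurj hT hc hr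

/-! ### §4 THE W-BRIDGES to LINE v8.17's residues R_N and R_S -/

/-- **W-BRIDGE N: R_N `DoorIndexLawFullCAtTwoSomeDoorResidueNonEgg` FROM Q4_T `KolyvaginExactAtTwoPosDiscT` (stmt-23240) BY NAME** + Kolyvagin's conjecture at `2` on
the slice's doors with `Δ_W > 0` + `S_manin` + PRINT⁶ (Gross–Zagier, Kolyvagin, GZK, modularity, Hoffstein–Luo, Milne any-model) + rank-`0` `BSD₂`.  R_N's habitat
(`Δ_W > 0`, `Ш(W)[2] = 0`, non-egg; odd Tamagawa from the slice) lies inside Q4_T's (`Δ_W > 0`, odd Tamagawa): `BSDp W 2` there (`bsdp_two_of_kolyvaginExactAtTwoPosDiscT`)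
and `hasLawfulDoorAtTwo_of_bsdp_two`.  Q2 / Q3R_T are NOT needed for R_N.  CONDITIONAL by design; nothing is asserted about the items.
[cite: GrossLMS1991, §2 Conj. (2.2), §3 and §10] [cite: Kramer1981, Prop. 6] [cite: Kolyvagin1990, Thm. A] -/
theorem residueNonEgg_of_kolyvaginExactAtTwoPosDiscT
    (hGZ : ∀ (N : ℕ) [NeZero N] (W : WeierstrassCurve ℚ) (K : Type) [Field K] [NumberField K], gross_zagier N W K)
    (hKo : ∀ (N : ℕ) [NeZero N] (W : WeierstrassCurve ℚ) (K : Type) [Field K] [NumberField K], kolyvagin N W K)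
    (hGZK : rank_eq_analyticRank_of_analyticRank_le_one) (hnf : exists_isNewformOf)
    (hHL : HoffsteinLuo1997_exists_twist_L_one_ne_zero) (hMilneC : Milne1972.bsdQuotient_baseChange_quadratic_anyModel)
    (hX4 : KolyvaginExactAtTwoPosDiscT) (hMan : S_manin)
    (hKC : ∀ (W : WeierstrassCurve ℚ) [W.IsElliptic] [W.IsGloballyMinimal] [NeZero (W.conductorNorm ℤ)],
      ¬ W.HasCM → (∀ n : ℕ, W.HasSurjectiveModNGaloisRep ((2 ^ n : ℕ) : ℤ)) → Odd W.tamagawaProduct → W.analyticRank = 1 → 0 < W.Δ →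
      ∀ (K : Type) [Field K] [NumberField K], IsImaginaryQuadratic K → Odd (NumberField.discr K) →
        NumberField.discr K ≠ -3 → SatisfiesHeegnerHypothesis (W.conductorNorm ℤ) K →
        ¬ IsSquare ((NumberField.discr K : ℚ) * -|W.Δ|) → ¬ IsSquare ((NumberField.discr K : ℚ) * (-(2 * |W.Δ|))) →
        ∀ (Dt : ModularParametrizationData W (W.conductorNorm ℤ)) (β : ℤ) (ι : K →+* ℂ) (d₁ : KolyvaginHeegnerData Dt β ι 1),
          Odd Dt.c → ¬ IsOfFinAddOrder d₁.derivedPoint →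
          ∃ (n : ℕ) (d : KolyvaginHeegnerData Dt β ι n), Squarefree n ∧
            (∀ ℓ ∈ n.primeFactors, Zhang2014.IsKolyvaginPrime (W.conductorNorm ℤ) W K 2 ℓ) ∧
            ¬ ∃ Q : (W.baseChange (ringClassField K ι n)).toAffine.Point, (2 : ℤ) • Q = d.derivedPoint)
    (hZ : S_rankZeroTwin) : DoorIndexLawFullCAtTwoSomeDoorResidueNonEgg := by
  intro W _ _ _ hCM hsurj hT hc hr hΔ _ _
  exact hasLawfulDoorAtTwo_of_bsdp_two hGZ hKo hnf hHL hZ W hCM hT hc hr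
    (bsdp_two_of_kolyvaginExactAtTwoPosDiscT hGZ hGZK hnf hHL hMilneC hX4 hMan hKC hZ W hCM hsurj hT hc hr hΔ)

/-- **W-BRIDGE S: R_S `DoorIndexLawFullCAtTwoSomeDoorResidueSha` FROM THE T-ITEMS {Q4_T (stmt-23240), Q2 (stmt-24880) + Q3R_T (stmt-23239)} BY NAME** + Kolyvagin's
conjecture at `2` on the slice's doors + `S_manin` + PRINT⁶ + rank-`0` `BSD₂`: R_S's habitat (`Ш(W)[2] ≠ 0`, either sign of `Δ_W`) lies inside the slice, where
`bsdp_two_of_genusItemsT` gives `BSDp W 2`, and `hasLawfulDoorAtTwo_of_bsdp_two` a lawful door.  CONDITIONAL by design; nothing is asserted about the items.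
[cite: GrossLMS1991, §2 Conj. (2.2), §3 and §10] [cite: Kolyvagin1990, Thm. A] [cite: McCallumLMS1991, §5] -/
theorem residueSha_of_genusItemsT
    (hGZ : ∀ (N : ℕ) [NeZero N] (W : WeierstrassCurve ℚ) (K : Type) [Field K] [NumberField K], gross_zagier N W K)
    (hKo : ∀ (N : ℕ) [NeZero N] (W : WeierstrassCurve ℚ) (K : Type) [Field K] [NumberField K], kolyvagin N W K)
    (hGZK : rank_eq_analyticRank_of_analyticRank_le_one) (hnf : exists_isNewformOf)
    (hHL : HoffsteinLuo1997_exists_twist_L_one_ne_zero) (hMilneC : Milne1972.bsdQuotient_baseChange_quadratic_anyModel)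
    (hX4 : KolyvaginExactAtTwoPosDiscT) (hQ2 : KolyvaginRelationAtTwo) (hRT : EquivariantKolyvaginExactAtTwoRT) (hMan : S_manin)
    (hKC : ∀ (W : WeierstrassCurve ℚ) [W.IsElliptic] [W.IsGloballyMinimal] [NeZero (W.conductorNorm ℤ)],
      ¬ W.HasCM → (∀ n : ℕ, W.HasSurjectiveModNGaloisRep ((2 ^ n : ℕ) : ℤ)) → Odd W.tamagawaProduct → W.analyticRank = 1 →
      ∀ (K : Type) [Field K] [NumberField K], IsImaginaryQuadratic K → Odd (NumberField.discr K) →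
        NumberField.discr K ≠ -3 → SatisfiesHeegnerHypothesis (W.conductorNorm ℤ) K →
        ¬ IsSquare ((NumberField.discr K : ℚ) * -|W.Δ|) → ¬ IsSquare ((NumberField.discr K : ℚ) * (-(2 * |W.Δ|))) →
        ∀ (Dt : ModularParametrizationData W (W.conductorNorm ℤ)) (β : ℤ) (ι : K →+* ℂ) (d₁ : KolyvaginHeegnerData Dt β ι 1),
          Odd Dt.c → ¬ IsOfFinAddOrder d₁.derivedPoint →
          ∃ (n : ℕ) (d : KolyvaginHeegnerData Dt β ι n), Squarefree n ∧
            (∀ ℓ ∈ n.primeFactors, Zhang2014.IsKolyvaginPrime (W.conductorNorm ℤ) W K 2 ℓ) ∧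
            ¬ ∃ Q : (W.baseChange (ringClassField K ι n)).toAffine.Point, (2 : ℤ) • Q = d.derivedPoint)
    (hZ : S_rankZeroTwin) : DoorIndexLawFullCAtTwoSomeDoorResidueSha := by
  intro W _ _ _ hCM hsurj hT hc hr _
  exact hasLawfulDoorAtTwo_of_bsdp_two hGZ hKo hnf hHL hZ W hCM hT hc hr
    (bsdp_two_of_genusItemsT hGZ hGZK hnf hHL hMilneC hX4 hQ2 hRT hMan hKC hZ W hCM hsurj hT hc hr)

end Summit.BirchSwinnertonDyer.BirchSwinnertonDyer.Theorems.RankOneAtTwoOneDoor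

end
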